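import Mathlib.Analysis.Calculus.Taylor
import Mathlib.Analysis.Calculus.IteratedDeriv.Lemmas
import Summits.AtomisticToContinuum.Crystallization.Theorems.ChessboardParticlePlanesPeriodicWindowsHcPhiTaylor

/-!
# Crux `PeriodicWindows` (stmt-AtomisticToContinuum-3240), line `dense-laminar-hull` — stub `hc_phiTaylor3`
# Tight order-three Taylor bound for `f(x) = (1/12) x⁻⁶ − (1/6) x⁻³`

For `f(x) := (1/12) x⁻⁶ − (1/6) x⁻³` (so that `f(H² + ‖u‖²)` is one term of the general-offset layer
interaction) we prove, for `x, y ≥ m > 0`, the order-three Taylor bound with the **Lagrange constant**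
`(1/4!) · sup_{[m,∞)} |f''''|`:

`|f(y) − f(x) − f'(x)(y − x) − ½ f''(x)(y − x)² − (1/6) f'''(x)(y − x)³| ≤ (1/24)(252 m⁻¹⁰ + 60 m⁻⁷)(y − x)⁴`,

where `f' = −(1/2)x⁻⁷ + (1/2)x⁻⁴`, `f'' = (7/2)x⁻⁸ − 2x⁻⁵`, `f''' = −28x⁻⁹ + 10x⁻⁶`, `f'''' = 252x⁻¹⁰ − 60x⁻⁷`
and `|f''''| ≤ 252 m⁻¹⁰ + 60 m⁻⁷` on `[m, ∞)`.

Route: Mathlib's Taylor theorem with Lagrange remainder on the unordered segment `uIcc x y`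
(`taylor_mean_remainder_lagrange_iteratedDeriv`, which covers `x < y` and `y < x` at once): `f` is smooth away
from `0`, its global iterated derivatives `iteratedDeriv k f` (`k ≤ 4`) are computed on the open set `{t ≠ 0}`
by `iteratedDeriv (k+1) f = deriv (iteratedDeriv k f)` and a local `EventuallyEq` (`hcp3_iteratedDeriv_succ_of_ne`),
the Taylor polynomial `taylorWithinEval f 3 (uIcc x y) x y` is identified through
`iteratedDerivWithin_eq_iteratedDeriv` at the endpoint `x`, and the remainder `f''''(x') (y − x)⁴ / 4!` with
`x' ∈ uIoo x y ⊆ [m, ∞)` is bounded by the crude sup bound. [folklore]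
-/

noncomputable section

namespace Summit.AtomisticToContinuum.Crystallization.Theorems.PeriodicWindowsDenseLaminarHull

open Literature.MathematicalPhysics.StatisticalMechanics Filter Metric
open scoped BigOperators Topology

/-! ## The fourth derivative and its sup bound -/

/-- `f''''`: `d/dt [−28 t⁻⁹ + 10 t⁻⁶] = 252 t⁻¹⁰ − 60 t⁻⁷` at `t = x ≠ 0`. [folklore] -/
theorem hcp3_f'''_hasDerivAt {x : ℝ} (hx : x ≠ 0) :
    HasDerivAt (fun t : ℝ => -28 * (t⁻¹) ^ 9 + 10 * (t⁻¹) ^ 6)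
      (252 * (x⁻¹) ^ 10 - 60 * (x⁻¹) ^ 7) x := by
  refine (((hcp_hasDerivAt_inv_pow hx 9).const_mul (-28)).add
    ((hcp_hasDerivAt_inv_pow hx 6).const_mul 10)).congr_deriv ?_
  push_cast
  ring

/-- `|f''''(t)| ≤ 252 m⁻¹⁰ + 60 m⁻⁷` for `t ≥ m > 0`. [folklore] -/
theorem hcp3_f''''_bound {m t : ℝ} (hm : 0 < m) (ht : m ≤ t) :
    |(252 : ℝ) * (t⁻¹) ^ 10 - 60 * (t⁻¹) ^ 7| ≤ 252 * (m⁻¹) ^ 10 + 60 * (m⁻¹) ^ 7 := by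
  have ht0 : 0 ≤ t⁻¹ := inv_nonneg.mpr (hm.le.trans ht)
  have hle : t⁻¹ ≤ m⁻¹ := inv_anti₀ hm ht
  have h10 : (t⁻¹) ^ 10 ≤ (m⁻¹) ^ 10 := pow_le_pow_left₀ ht0 hle 10
  have h7 : (t⁻¹) ^ 7 ≤ (m⁻¹) ^ 7 := pow_le_pow_left₀ ht0 hle 7
  have h10' : 0 ≤ (t⁻¹) ^ 10 := pow_nonneg ht0 10
  have h7' : 0 ≤ (t⁻¹) ^ 7 := pow_nonneg ht0 7
  rw [abs_le]
  constructor <;> linarith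

/-! ## Smoothness and the global iterated derivatives of `f` away from `0` -/

/-- `f(t) = (1/12) t⁻⁶ − (1/6) t⁻³` is `C^n` at every `t ≠ 0`. [folklore] -/
theorem hcp3_f_contDiffAt {t : ℝ} (ht : t ≠ 0) {n : WithTop ℕ∞} :
    ContDiffAt ℝ n (fun t : ℝ => (1 / 12) * (t⁻¹) ^ 6 - (1 / 6) * (t⁻¹) ^ 3) t := by
  have hi : ContDiffAt ℝ n (fun u : ℝ => u⁻¹) t := contDiffAt_inv ℝ ht
  exact (contDiffAt_const.mul (hi.pow 6)).sub (contDiffAt_const.mul (hi.pow 3))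

/-- Iterated derivatives on the open set `{t ≠ 0}`: if `iteratedDeriv k F = G` on `{t ≠ 0}` and `G` has
derivative `G'` there, then `iteratedDeriv (k+1) F = G'` on `{t ≠ 0}` (`iteratedDeriv_succ` and locality of
`deriv`). [folklore] -/
theorem hcp3_iteratedDeriv_succ_of_ne {F G G' : ℝ → ℝ} {k : ℕ}
    (hk : ∀ t : ℝ, t ≠ 0 → iteratedDeriv k F t = G t) (hG : ∀ t : ℝ, t ≠ 0 → HasDerivAt G (G' t) t)
    {t : ℝ} (ht : t ≠ 0) : iteratedDeriv (k + 1) F t = G' t := by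
  have h : iteratedDeriv k F =ᶠ[𝓝 t] G := by
    filter_upwards [eventually_ne_nhds ht] with u hu using hk u hu
  rw [iteratedDeriv_succ, h.deriv_eq, (hG t ht).deriv]

/-- `iteratedDeriv 1 f = f' = −(1/2) t⁻⁷ + (1/2) t⁻⁴` at `t ≠ 0`. [folklore] -/
theorem hcp3_f_iteratedDeriv_one {t : ℝ} (ht : t ≠ 0) :
    iteratedDeriv 1 (fun t : ℝ => (1 / 12) * (t⁻¹) ^ 6 - (1 / 6) * (t⁻¹) ^ 3) t =
      -(1 / 2) * (t⁻¹) ^ 7 + (1 / 2) * (t⁻¹) ^ 4 :=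
  hcp3_iteratedDeriv_succ_of_ne (k := 0)
    (F := fun t : ℝ => (1 / 12) * (t⁻¹) ^ 6 - (1 / 6) * (t⁻¹) ^ 3)
    (G := fun t : ℝ => (1 / 12) * (t⁻¹) ^ 6 - (1 / 6) * (t⁻¹) ^ 3)
    (G' := fun t : ℝ => -(1 / 2) * (t⁻¹) ^ 7 + (1 / 2) * (t⁻¹) ^ 4)
    (fun u _ => congrFun iteratedDeriv_zero u)
    (fun _ hu => NashTwoShellGapForceBalance.hasDerivAt_profile hu) ht

/-- `iteratedDeriv 2 f = f'' = (7/2) t⁻⁸ − 2 t⁻⁵` at `t ≠ 0`. [folklore] -/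
theorem hcp3_f_iteratedDeriv_two {t : ℝ} (ht : t ≠ 0) :
    iteratedDeriv 2 (fun t : ℝ => (1 / 12) * (t⁻¹) ^ 6 - (1 / 6) * (t⁻¹) ^ 3) t =
      (7 / 2) * (t⁻¹) ^ 8 - 2 * (t⁻¹) ^ 5 :=
  hcp3_iteratedDeriv_succ_of_ne (k := 1)
    (F := fun t : ℝ => (1 / 12) * (t⁻¹) ^ 6 - (1 / 6) * (t⁻¹) ^ 3)
    (G := fun t : ℝ => -(1 / 2) * (t⁻¹) ^ 7 + (1 / 2) * (t⁻¹) ^ 4)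
    (G' := fun t : ℝ => (7 / 2) * (t⁻¹) ^ 8 - 2 * (t⁻¹) ^ 5)
    (fun _ hu => hcp3_f_iteratedDeriv_one hu)
    (fun _ hu => NashTwoShellGapSiteStability.hasDerivAt_profileDeriv hu) ht

/-- `iteratedDeriv 3 f = f''' = −28 t⁻⁹ + 10 t⁻⁶` at `t ≠ 0`. [folklore] -/
theorem hcp3_f_iteratedDeriv_three {t : ℝ} (ht : t ≠ 0) :
    iteratedDeriv 3 (fun t : ℝ => (1 / 12) * (t⁻¹) ^ 6 - (1 / 6) * (t⁻¹) ^ 3) t =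
      -28 * (t⁻¹) ^ 9 + 10 * (t⁻¹) ^ 6 :=
  hcp3_iteratedDeriv_succ_of_ne (k := 2)
    (F := fun t : ℝ => (1 / 12) * (t⁻¹) ^ 6 - (1 / 6) * (t⁻¹) ^ 3)
    (G := fun t : ℝ => (7 / 2) * (t⁻¹) ^ 8 - 2 * (t⁻¹) ^ 5)
    (G' := fun t : ℝ => -28 * (t⁻¹) ^ 9 + 10 * (t⁻¹) ^ 6)
    (fun _ hu => hcp3_f_iteratedDeriv_two hu)
    (fun _ hu => hcp_f''_hasDerivAt hu) ht

/-- `iteratedDeriv 4 f = f'''' = 252 t⁻¹⁰ − 60 t⁻⁷` at `t ≠ 0`. [folklore] -/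
theorem hcp3_f_iteratedDeriv_four {t : ℝ} (ht : t ≠ 0) :
    iteratedDeriv 4 (fun t : ℝ => (1 / 12) * (t⁻¹) ^ 6 - (1 / 6) * (t⁻¹) ^ 3) t =
      252 * (t⁻¹) ^ 10 - 60 * (t⁻¹) ^ 7 :=
  hcp3_iteratedDeriv_succ_of_ne (k := 3)
    (F := fun t : ℝ => (1 / 12) * (t⁻¹) ^ 6 - (1 / 6) * (t⁻¹) ^ 3)
    (G := fun t : ℝ => -28 * (t⁻¹) ^ 9 + 10 * (t⁻¹) ^ 6)
    (G' := fun t : ℝ => 252 * (t⁻¹) ^ 10 - 60 * (t⁻¹) ^ 7)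
    (fun _ hu => hcp3_f_iteratedDeriv_three hu)
    (fun _ hu => hcp3_f'''_hasDerivAt hu) ht

/-! ## The stub -/

/-- **Stub `hc_phiTaylor3`** (line `dense-laminar-hull`, wave 2): for `f(x) = (1/12) x⁻⁶ − (1/6) x⁻³` and
`x, y ≥ m > 0`, the order-three Taylor bound with Lagrange's constant,
`|f(y) − f(x) − f'(x)(y − x) − ½ f''(x)(y − x)² − (1/6) f'''(x)(y − x)³| ≤ (1/24)(252 m⁻¹⁰ + 60 m⁻⁷)(y − x)⁴`
(Taylor's theorem with the Lagrange remainder `f''''(x')(y − x)⁴/4!`, `x'` between `x` and `y`, and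
`|f''''| ≤ 252 m⁻¹⁰ + 60 m⁻⁷` on `[m, ∞)`). [folklore] -/
theorem hc_phiTaylor3 : ∀ x y m : ℝ, 0 < m → m ≤ x → m ≤ y →
    |((1 / 12 : ℝ) * (y⁻¹) ^ 6 - (1 / 6) * (y⁻¹) ^ 3) - ((1 / 12) * (x⁻¹) ^ 6 - (1 / 6) * (x⁻¹) ^ 3) -
        (-(1 / 2) * (x⁻¹) ^ 7 + (1 / 2) * (x⁻¹) ^ 4) * (y - x) -
        (1 / 2) * ((7 / 2) * (x⁻¹) ^ 8 - 2 * (x⁻¹) ^ 5) * (y - x) ^ 2 -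
        (1 / 6) * (-28 * (x⁻¹) ^ 9 + 10 * (x⁻¹) ^ 6) * (y - x) ^ 3| ≤
      (1 / 24) * (252 * (m⁻¹) ^ 10 + 60 * (m⁻¹) ^ 7) * (y - x) ^ 4 := by
  intro x y m hm hx hy
  rcases eq_or_ne x y with rfl | hxy
  · simp
  have hx0 : x ≠ 0 := (hm.trans_le hx).ne'
  -- Taylor's theorem with the Lagrange remainder on the unordered segment `uIcc x y ⊆ [m, ∞)`
  obtain ⟨x', hx', hrem⟩ := taylor_mean_remainder_lagrange_iteratedDeriv (n := 3)
    (f := fun t : ℝ => (1 / 12) * (t⁻¹) ^ 6 - (1 / 6) * (t⁻¹) ^ 3) hxy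
    (fun t ht => (hcp3_f_contDiffAt (hm.trans_le (hcp_le_of_mem_uIcc hx hy ht)).ne').contDiffWithinAt)
  have hx'm : m ≤ x' := ((le_min hx hy).trans_lt hx'.1).le
  have hx'0 : x' ≠ 0 := (hm.trans_le hx'm).ne'
  -- the Taylor polynomial of order three at `x`
  have hW : ∀ k : ℕ, iteratedDerivWithin k (fun t : ℝ => (1 / 12) * (t⁻¹) ^ 6 - (1 / 6) * (t⁻¹) ^ 3)
      (Set.uIcc x y) x = iteratedDeriv k (fun t : ℝ => (1 / 12) * (t⁻¹) ^ 6 - (1 / 6) * (t⁻¹) ^ 3) x :=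
    fun k => iteratedDerivWithin_eq_iteratedDeriv (uniqueDiffOn_Icc (min_lt_max.mpr hxy))
      (hcp3_f_contDiffAt hx0) Set.left_mem_uIcc
  have h2f : ((Nat.factorial 2 : ℕ) : ℝ) = 2 := by norm_num [Nat.factorial]
  have h3f : ((Nat.factorial 3 : ℕ) : ℝ) = 6 := by norm_num [Nat.factorial]
  have hT : taylorWithinEval (fun t : ℝ => (1 / 12) * (t⁻¹) ^ 6 - (1 / 6) * (t⁻¹) ^ 3) 3 (Set.uIcc x y) x y =
      ((1 / 12) * (x⁻¹) ^ 6 - (1 / 6) * (x⁻¹) ^ 3) + (-(1 / 2) * (x⁻¹) ^ 7 + (1 / 2) * (x⁻¹) ^ 4) * (y - x) +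
        (1 / 2) * ((7 / 2) * (x⁻¹) ^ 8 - 2 * (x⁻¹) ^ 5) * (y - x) ^ 2 +
        (1 / 6) * (-28 * (x⁻¹) ^ 9 + 10 * (x⁻¹) ^ 6) * (y - x) ^ 3 := by
    rw [taylor_within_apply]
    simp only [Finset.sum_range_succ, Finset.sum_range_zero, zero_add, hW, iteratedDeriv_zero,
      hcp3_f_iteratedDeriv_one hx0, hcp3_f_iteratedDeriv_two hx0, hcp3_f_iteratedDeriv_three hx0,
      smul_eq_mul, Nat.factorial_zero, Nat.factorial_one, Nat.cast_one, inv_one, pow_zero, pow_one,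
      one_mul, h2f, h3f]
    ring
  -- the remainder
  have h4 : iteratedDeriv (3 + 1) (fun t : ℝ => (1 / 12) * (t⁻¹) ^ 6 - (1 / 6) * (t⁻¹) ^ 3) x' =
      252 * (x'⁻¹) ^ 10 - 60 * (x'⁻¹) ^ 7 := hcp3_f_iteratedDeriv_four hx'0
  have hfac : ((Nat.factorial (3 + 1) : ℕ) : ℝ) = 24 := by norm_num [Nat.factorial]
  rw [hT, h4, hfac] at hrem
  have key : ((1 / 12 : ℝ) * (y⁻¹) ^ 6 - (1 / 6) * (y⁻¹) ^ 3) - ((1 / 12) * (x⁻¹) ^ 6 - (1 / 6) * (x⁻¹) ^ 3) -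
        (-(1 / 2) * (x⁻¹) ^ 7 + (1 / 2) * (x⁻¹) ^ 4) * (y - x) -
        (1 / 2) * ((7 / 2) * (x⁻¹) ^ 8 - 2 * (x⁻¹) ^ 5) * (y - x) ^ 2 -
        (1 / 6) * (-28 * (x⁻¹) ^ 9 + 10 * (x⁻¹) ^ 6) * (y - x) ^ 3 =
      (252 * (x'⁻¹) ^ 10 - 60 * (x'⁻¹) ^ 7) * (y - x) ^ 4 / 24 := by
    linear_combination hrem
  have h4n : 0 ≤ (y - x) ^ 4 := by positivity
  rw [key, abs_div, abs_mul, abs_of_nonneg h4n, abs_of_pos (by norm_num : (0 : ℝ) < 24)]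
  have hb := hcp3_f''''_bound hm hx'm
  calc |252 * (x'⁻¹) ^ 10 - 60 * (x'⁻¹) ^ 7| * (y - x) ^ 4 / 24
      ≤ (252 * (m⁻¹) ^ 10 + 60 * (m⁻¹) ^ 7) * (y - x) ^ 4 / 24 := by gcongr
    _ = (1 / 24) * (252 * (m⁻¹) ^ 10 + 60 * (m⁻¹) ^ 7) * (y - x) ^ 4 := by ring

end Summit.AtomisticToContinuum.Crystallization.Theorems.PeriodicWindowsDenseLaminarHull

end
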